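import Summits.Ventures.Crystal3D.Bulk.GapKiteHoleCorner
import Summits.Ventures.Crystal3D.Bulk.GapRhombus
import HarnessLib

/-!
# The two-corner row of the P-kite: `A_p − α₀ ≤ u_p − u_b ≤ 2A_p − 2A_x` (hole corner minus far
# corner is monotone along the kite family) — for every admissible configuration, no calculus

HONEST FRAMING. Part of the venture `Summits/Ventures/Crystal3D` (cell `pub-crystal3d`, phase 2;
seat p2, PROMOTION-AUDIT prep, memo r1.1 A6 (b1): rows 27/28 of the B-lineage tables `PZ4_I` /
`PZ4_W1`, `u₂ − u₄ ≤ b` and `u₄ − u₂ ≤ b`). Kernel theorems about an ADMISSIBLE fourteen-ball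
configuration `c` (`IsGapConfig c`; no extremality, no convexity / face hypothesis) and one lemma of
plane trigonometry; nothing here asserts anything about GAP(1.26), moves no census number.

In a P-kite `(p, a, b, e)` (the intruder `p` tight to the shell balls `a ≠ e`, a shell ball `b`
tight to `a` and `e`) the hole corner `u_p = corner c 13 a e` and the far corner
`u_b = corner c b a e` satisfy, with `G = ⟪u_a, u_e⟫`, `cos u_p = (G − D²/4)/(1 − D²/4)`
(`IsGapConfig.cos_hole_corner`) and `cos u_b = (4G − 1)/3` (`IsGapConfig.cos_corner_rhombus`), hence
THE SINE RULE of the triangle `(p, a, b)`: `(4 − D²)(1 − cos u_p) = 3(1 − cos u_b)`, i.e.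
`sin (u_p/2) = s · sin (u_b/2)` with `s = √3/√(4 − D²) ≥ 1` (`D ≥ 1`). Along any curve
`sin Y = s·sin x` (`x, Y ∈ [0, π/2]`, `s ≥ 1`) the difference `Y − x` is MONOTONE in `Y`
(**`sub_le_sub_of_sin_eq_mul_sin`**, proved without calculus from `sin Y − sin x =
2 sin ((Y−x)/2) cos ((Y+x)/2)`). The two ends of the kite family lie on the same curve —
`(x, Y) = (A_x, A_p)` at `|pb| = ρ` and `(α₀/2, A_p/2)` at `|ae| = 60°` — and the tree's rows
`A_p ≤ u_p ≤ 2A_p` (`arccos_Ap_le_corner`, `hole_corner_kite_le`) place `u_p/2` between them, so: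

* **`IsGapConfig.kite_hole_sub_far_corner`**: `A_p(D) − arccos (1/3) ≤ u_p − u_b ≤ 2A_p(D) − 2A_x(D)`
  for every P-kite of every admissible configuration with `D² ≤ 2`
  (`A_p = arccos ((2 − D²)/(4 − D²))`, `A_x = arccos (D/(√3 √(4 − D²)))`).

The literal rows 27/28 of the two tables follow in the assembly file `Bulk/GapKitePZ4Rows.lean`.
-/

noncomputable section

open scoped BigOperators InnerProductSpace
open Finset Real

namespace Summit.Ventures.Crystal3D

/-! ## §1 Plane trigonometry: `Y − x` is monotone along `sin Y = s·sin x`, `s ≥ 1` -/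

/-- `sin² (x/2) = (1 − cos x)/2`. [folklore] -/
theorem sin_sq_half_eq (x : ℝ) : Real.sin (x / 2) ^ 2 = (1 - Real.cos x) / 2 := by
  have h1 := Real.cos_sq (x / 2)
  rw [show 2 * (x / 2) = x by ring] at h1
  have h2 := Real.sin_sq_add_cos_sq (x / 2)
  linarith

/-- **Monotonicity along a sine-rule curve, without calculus.** If `sin Y₁ = s·sin x₁`,
`sin Y₂ = s·sin x₂` with `s ≥ 1`, all four angles in `[0, π/2]`, and `Y₁ ≤ Y₂`, then
`Y₁ − x₁ ≤ Y₂ − x₂`. (From `(s − 1) sin xᵢ = 2 sin ((Yᵢ − xᵢ)/2) cos ((Yᵢ + xᵢ)/2)`: the left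
sides increase from `1` to `2`, the cosines decrease, so the sines of the half-differences cannot
decrease.) [folklore] -/
theorem sub_le_sub_of_sin_eq_mul_sin {s x₁ x₂ Y₁ Y₂ : ℝ} (hs : 1 ≤ s)
    (hx₁ : 0 ≤ x₁) (hx₁' : x₁ ≤ π / 2) (hx₂ : 0 ≤ x₂) (hx₂' : x₂ ≤ π / 2)
    (hY₁ : 0 ≤ Y₁) (hY₁' : Y₁ ≤ π / 2) (hY₂ : 0 ≤ Y₂) (hY₂' : Y₂ ≤ π / 2)
    (h₁ : Real.sin Y₁ = s * Real.sin x₁) (h₂ : Real.sin Y₂ = s * Real.sin x₂) (hY : Y₁ ≤ Y₂) :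
    Y₁ - x₁ ≤ Y₂ - x₂ := by
  have hπ := Real.pi_pos
  have hsx₁ : 0 ≤ Real.sin x₁ := sin_nonneg_of_nonneg_of_le_pi hx₁ (by linarith)
  have hsx₂ : 0 ≤ Real.sin x₂ := sin_nonneg_of_nonneg_of_le_pi hx₂ (by linarith)
  -- `sin x₁ ≤ sin x₂`, hence `x₁ ≤ x₂`
  have hsY : Real.sin Y₁ ≤ Real.sin Y₂ := sin_le_sin_of_le_of_le_pi_div_two (by linarith) hY₂' hY
  have hsx : Real.sin x₁ ≤ Real.sin x₂ := by
    have h : s * Real.sin x₁ ≤ s * Real.sin x₂ := by rw [← h₁, ← h₂]; exact hsY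
    exact le_of_mul_le_mul_left h (by linarith)
  have hx : x₁ ≤ x₂ := by
    by_contra h
    push Not at h
    have := sin_lt_sin_of_lt_of_le_pi_div_two (by linarith) hx₁' h
    linarith
  -- `xᵢ ≤ Yᵢ`
  have hxY₁ : x₁ ≤ Y₁ := by
    by_contra h
    push Not at h
    have := sin_lt_sin_of_lt_of_le_pi_div_two (by linarith) hx₁' h
    nlinarith
  have hxY₂ : x₂ ≤ Y₂ := by
    by_contra h
    push Not at h
    have := sin_lt_sin_of_lt_of_le_pi_div_two (by linarith) hx₂' h
    nlinarith
  by_contra hlt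
  push Not at hlt
  -- the two prosthaphaeresis identities
  have e₁ : (s - 1) * Real.sin x₁ = 2 * Real.sin ((Y₁ - x₁) / 2) * Real.cos ((Y₁ + x₁) / 2) := by
    rw [← Real.sin_sub_sin]; linarith
  have e₂ : (s - 1) * Real.sin x₂ = 2 * Real.sin ((Y₂ - x₂) / 2) * Real.cos ((Y₂ + x₂) / 2) := by
    rw [← Real.sin_sub_sin]; linarith
  have hcmp : (s - 1) * Real.sin x₁ ≤ (s - 1) * Real.sin x₂ :=
    mul_le_mul_of_nonneg_left hsx (by linarith)
  rw [e₁, e₂] at hcmp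
  -- sines of the half-differences and cosines of the half-sums
  have hδ : Real.sin ((Y₂ - x₂) / 2) < Real.sin ((Y₁ - x₁) / 2) :=
    sin_lt_sin_of_lt_of_le_pi_div_two (by linarith) (by linarith) (by linarith)
  have hδ₂ : 0 ≤ Real.sin ((Y₂ - x₂) / 2) := sin_nonneg_of_nonneg_of_le_pi (by linarith) (by linarith)
  have hμ : Real.cos ((Y₂ + x₂) / 2) ≤ Real.cos ((Y₁ + x₁) / 2) :=
    Real.cos_le_cos_of_nonneg_of_le_pi (by linarith) (by linarith) (by linarith)
  have hμ₂ : 0 ≤ Real.cos ((Y₂ + x₂) / 2) :=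
    cos_nonneg_of_neg_pi_div_two_le_of_le (by linarith) (by linarith)
  have hμ₁ : 0 ≤ Real.cos ((Y₁ + x₁) / 2) :=
    cos_nonneg_of_neg_pi_div_two_le_of_le (by linarith) (by linarith)
  rcases hμ₁.eq_or_lt with h0 | hpos
  · -- `cos ((Y₁ + x₁)/2) = 0` forces `x₁ = Y₁ = π/2`, so `Y₁ − x₁ = 0 ≤ Y₂ − x₂`
    have hlt2 : (Y₁ + x₁) / 2 < π / 2 ∨ (Y₁ + x₁) / 2 = π / 2 := by
      rcases lt_or_eq_of_le (show (Y₁ + x₁) / 2 ≤ π / 2 by linarith) with h | h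
      · exact Or.inl h
      · exact Or.inr h
    rcases hlt2 with hlt2 | heq2
    · have : 0 < Real.cos ((Y₁ + x₁) / 2) := Real.cos_pos_of_mem_Ioo ⟨by linarith, hlt2⟩
      linarith
    · have hx1 : x₁ = π / 2 := by linarith
      have hy1 : Y₁ = π / 2 := by linarith
      linarith
  · -- `cos ((Y₁ + x₁)/2) > 0`: cancel it
    have h3 : 2 * Real.sin ((Y₂ - x₂) / 2) * Real.cos ((Y₂ + x₂) / 2) ≤
        2 * Real.sin ((Y₂ - x₂) / 2) * Real.cos ((Y₁ + x₁) / 2) := by nlinarith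
    have h4 : Real.sin ((Y₁ - x₁) / 2) * Real.cos ((Y₁ + x₁) / 2) ≤
        Real.sin ((Y₂ - x₂) / 2) * Real.cos ((Y₁ + x₁) / 2) := by linarith
    have h5 : Real.sin ((Y₁ - x₁) / 2) ≤ Real.sin ((Y₂ - x₂) / 2) :=
      le_of_mul_le_mul_right h4 hpos
    linarith

/-! ## §2 The kite row -/

section Config

open Literature.Geometry.DiscreteGeometry InnerProductGeometry

variable {c : Fin 14 → EuclideanSpace ℝ (Fin 3)}

/-- **The sine rule of the triangle `(p, a, b)` in a P-kite**: with `u_p = corner c 13 a e` and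
`u_b = corner c b a e`, `(4 − D²)(1 − cos u_p) = 3 (1 − cos u_b)` (both equal `4(1 − ⟪u_a,u_e⟫)`).
[folklore] -/
theorem IsGapConfig.kite_sine_rule (hc : IsGapConfig c) (hD : intruderDist c < 2)
    {a e b : Fin 14} (ha0 : a ≠ 0) (ha13 : a ≠ 13) (he0 : e ≠ 0) (he13 : e ≠ 13) (hb0 : b ≠ 0)
    (hb13 : b ≠ 13) (ha : dist (c a) (c 13) = 1) (he : dist (c e) (c 13) = 1)
    (hba : dist (c b) (c a) = 1) (hbe : dist (c b) (c e) = 1) :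
    (4 - intruderDist c ^ 2) * (1 - Real.cos (corner c 13 a e)) =
      3 * (1 - Real.cos (corner c b a e)) := by
  have hD1 : 1 ≤ intruderDist c := hc.one_le_intruderDist
  have h14 : (1 : ℝ) - intruderDist c ^ 2 / 4 ≠ 0 := by nlinarith
  have h4 : (4 : ℝ) - intruderDist c ^ 2 ≠ 0 := by nlinarith
  rw [hc.cos_hole_corner hD ha0 he0 ha he, hc.cos_corner_rhombus hb0 hb13 ha0 ha13 he0 he13 hba hbe]
  have e1 : (1 : ℝ) - intruderDist c ^ 2 / 4 = (4 - intruderDist c ^ 2) / 4 := by ring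
  rw [e1]
  field_simp
  ring

/-- **Row `A_p − α₀ ≤ u_p − u_b ≤ 2A_p − 2A_x` of the P-kite** (hole corner minus far corner), for
every admissible configuration with `D² ≤ 2` and every P-kite `(p, a, b, e)` (`a ≠ e` touching the
intruder, `b` touching `a` and `e`): with `A_p = arccos ((2 − D²)/(4 − D²))`,
`A_x = arccos (D/(√3 √(4 − D²)))`,
`A_p − arccos (1/3) ≤ corner c 13 a e − corner c b a e ≤ 2A_p − 2A_x`. Both ends are attained
(`|ae| = 60°`, resp. `|pb| = ρ`). Proof: the sine rule `sin (u_p/2) = s sin (u_b/2)`,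
`s = √3/√(4 − D²) ≥ 1`, the same relation at the two ends, and `sub_le_sub_of_sin_eq_mul_sin`.
[folklore] -/
theorem IsGapConfig.kite_hole_sub_far_corner (hc : IsGapConfig c) (hD2 : intruderDist c ^ 2 ≤ 2)
    {a e b : Fin 14} (ha0 : a ≠ 0) (ha13 : a ≠ 13) (he0 : e ≠ 0) (he13 : e ≠ 13) (hb0 : b ≠ 0)
    (hb13 : b ≠ 13) (hae : a ≠ e) (ha : dist (c a) (c 13) = 1) (he : dist (c e) (c 13) = 1)
    (hba : dist (c b) (c a) = 1) (hbe : dist (c b) (c e) = 1) :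
    Real.arccos ((2 - intruderDist c ^ 2) / (4 - intruderDist c ^ 2)) - Real.arccos (1 / 3) ≤
        corner c 13 a e - corner c b a e ∧
      corner c 13 a e - corner c b a e ≤
        2 * Real.arccos ((2 - intruderDist c ^ 2) / (4 - intruderDist c ^ 2)) -
          2 * Real.arccos (intruderDist c / (√3 * √(4 - intruderDist c ^ 2))) := by
  set D := intruderDist c with hDdef
  have hD1 : 1 ≤ D := hc.one_le_intruderDist
  have hD : D < 2 := by nlinarith
  have h4 : 0 < 4 - D ^ 2 := by nlinarith
  have hπ := Real.pi_pos
  set P := corner c 13 a e with hP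
  set Bf := corner c b a e with hBf
  set z := (2 - D ^ 2) / (4 - D ^ 2) with hz
  set w := D / (√3 * √(4 - D ^ 2)) with hw
  set s := √3 / √(4 - D ^ 2) with hs
  -- basic facts on `s`, `z`, `w`
  have hs3 : 0 < √3 := Real.sqrt_pos.2 (by norm_num)
  have hs4 : 0 < √(4 - D ^ 2) := Real.sqrt_pos.2 h4
  have hs0 : 0 < s := div_pos hs3 hs4
  have hs2 : s ^ 2 = 3 / (4 - D ^ 2) := by
    rw [hs, div_pow, Real.sq_sqrt (by norm_num : (0:ℝ) ≤ 3), Real.sq_sqrt h4.le]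
  have hs1 : 1 ≤ s := by
    have h1 : 1 ≤ s ^ 2 := by rw [hs2, le_div_iff₀ h4]; nlinarith
    nlinarith [hs0]
  have hz0 : 0 ≤ z := div_nonneg (by nlinarith) h4.le
  have hz1 : z ≤ 1 := by rw [hz, div_le_one h4]; linarith
  have hzm : -1 ≤ z := by linarith
  have hw0 : 0 ≤ w := div_nonneg (by linarith) (mul_pos hs3 hs4).le
  have hw2 : w ^ 2 = D ^ 2 / (3 * (4 - D ^ 2)) := by
    rw [hw, div_pow, mul_pow, Real.sq_sqrt (by norm_num : (0:ℝ) ≤ 3), Real.sq_sqrt h4.le]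
  have hw1 : w ≤ 1 := by
    have h : w ^ 2 ≤ 1 := by rw [hw2, div_le_one (by positivity)]; nlinarith
    nlinarith [hw0]
  -- the angles `A_p`, `A_x`, `α₀` and the corners live in `[0, π/2]` resp. `[0, π]`
  have hAp0 : 0 ≤ Real.arccos z := Real.arccos_nonneg z
  have hAp2 : Real.arccos z ≤ π / 2 := Real.arccos_le_pi_div_two.2 hz0
  have hAx0 : 0 ≤ Real.arccos w := Real.arccos_nonneg w
  have hAx2 : Real.arccos w ≤ π / 2 := Real.arccos_le_pi_div_two.2 hw0
  have hτ0 : 0 ≤ Real.arccos (1 / 3) := Real.arccos_nonneg _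
  have hτ2 : Real.arccos (1 / 3) ≤ π / 2 := Real.arccos_le_pi_div_two.2 (by norm_num)
  have hP0 : 0 ≤ P := InnerProductGeometry.angle_nonneg _ _
  have hPπ : P ≤ π := InnerProductGeometry.angle_le_pi _ _
  have hB0 : 0 ≤ Bf := InnerProductGeometry.angle_nonneg _ _
  have hBπ : Bf ≤ π := InnerProductGeometry.angle_le_pi _ _
  -- tree rows: `A_p ≤ P ≤ 2 A_p`, `α₀ ≤ Bf`
  have hPlo : Real.arccos z ≤ P := hc.arccos_Ap_le_corner hD ha0 ha13 he0 he13 ha he hae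
  have hPhi : P ≤ 2 * Real.arccos z :=
    hc.hole_corner_kite_le hD2 ha0 ha13 he0 he13 hb0 hb13 ha he hba hbe
  have hBlo : Real.arccos (1 / 3) ≤ Bf := hc.arccos_third_le_corner hb0 hb13 ha0 ha13 he0 he13 hba hbe hae
  -- the sine rule for the configuration, in half angles
  have hrule := hc.kite_sine_rule hD ha0 ha13 he0 he13 hb0 hb13 ha he hba hbe
  rw [← hDdef] at hrule
  have hsinP : 0 ≤ Real.sin (P / 2) := sin_nonneg_of_nonneg_of_le_pi (by linarith) (by linarith)
  have hsinB : 0 ≤ Real.sin (Bf / 2) := sin_nonneg_of_nonneg_of_le_pi (by linarith) (by linarith)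
  have hcfg : Real.sin (P / 2) = s * Real.sin (Bf / 2) := by
    have hsq : Real.sin (P / 2) ^ 2 = (s * Real.sin (Bf / 2)) ^ 2 := by
      rw [mul_pow, hs2, sin_sq_half_eq, sin_sq_half_eq, div_mul_eq_mul_div, eq_div_iff h4.ne']
      linarith
    exact (sq_eq_sq₀ hsinP (mul_nonneg hs0.le hsinB)).1 hsq
  -- the same rule at the two ends: `sin A_p = s sin A_x` and `sin (A_p/2) = s sin (α₀/2)`
  have hend1 : Real.sin (Real.arccos z) = s * Real.sin (Real.arccos w) := by
    have hl : 0 ≤ Real.sin (Real.arccos z) :=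
      sin_nonneg_of_nonneg_of_le_pi hAp0 (by linarith)
    have hr : 0 ≤ s * Real.sin (Real.arccos w) :=
      mul_nonneg hs0.le (sin_nonneg_of_nonneg_of_le_pi hAx0 (by linarith))
    have hsq : Real.sin (Real.arccos z) ^ 2 = (s * Real.sin (Real.arccos w)) ^ 2 := by
      rw [mul_pow, hs2, Real.sin_sq, Real.sin_sq, Real.cos_arccos hzm hz1,
        Real.cos_arccos (by linarith) hw1, hw2, hz]
      field_simp
      ring
    exact (sq_eq_sq₀ hl hr).1 hsq
  have hend2 : Real.sin (Real.arccos z / 2) = s * Real.sin (Real.arccos (1 / 3) / 2) := by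
    have hl : 0 ≤ Real.sin (Real.arccos z / 2) :=
      sin_nonneg_of_nonneg_of_le_pi (by linarith) (by linarith)
    have hr : 0 ≤ s * Real.sin (Real.arccos (1 / 3) / 2) :=
      mul_nonneg hs0.le (sin_nonneg_of_nonneg_of_le_pi (by linarith) (by linarith))
    have hsq : Real.sin (Real.arccos z / 2) ^ 2 = (s * Real.sin (Real.arccos (1 / 3) / 2)) ^ 2 := by
      rw [mul_pow, hs2, sin_sq_half_eq, sin_sq_half_eq, Real.cos_arccos hzm hz1,
        Real.cos_arccos (by norm_num) (by norm_num), hz]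
      field_simp
      ring
    exact (sq_eq_sq₀ hl hr).1 hsq
  constructor
  · -- lower end: `(x₁, Y₁) = (α₀/2, A_p/2)`, `(x₂, Y₂) = (Bf/2, P/2)`
    have h := sub_le_sub_of_sin_eq_mul_sin hs1 (by linarith) (by linarith) (by linarith)
      (by linarith) (by linarith) (by linarith) (by linarith) (by linarith) hend2 hcfg (by linarith)
    linarith
  · -- upper end: `(x₁, Y₁) = (Bf/2, P/2)`, `(x₂, Y₂) = (A_x, A_p)`
    have h := sub_le_sub_of_sin_eq_mul_sin hs1 (by linarith) (by linarith) hAx0 hAx2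
      (by linarith) (by linarith) hAp0 hAp2 hcfg hend1 (by linarith)
    linarith

end Config

end Summit.Ventures.Crystal3D

end
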